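import Summits.QuantumFields.BalabanUV.Beta.D1BFx.GhostNeedleRootedLetters
import Summits.QuantumFields.BalabanUV.Beta.D1BFx.CornerVBlockRank
import Summits.QuantumFields.BalabanUV.Beta.D1BFx.FineHessianSectors

/-!
# `BalabanUV.Beta.D1BFx.NeedleGhostBubblePointwise` — road «BF-x» for binder row D1, slot (K), END row `hGrp gN` (NEEDLES ∪ G_R), (N-2) rows
# «NT-4» ∕ «NT-5» FILE A: THE GHOST BUBBLE WORDS `ghCur ⊗ qA` AND `qA ⊗ ghCur` IN CLOSED FORM AND THEIR POINTWISE LETTER — one ghost current is a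
# DIPOLE at its bond, one rooted needle `qA = qAntiAt ρ n` is a block row ∕ column sum at ITS bond's block weighted by the jet `|qJetAt| ≤ n⁻⁴`, so
# `|T(κ,λ; p, u)| ≤ n⁻⁴·(rb(p)·ca(p+e_κ) + rb(p+e_κ)·ca(p))` with `ca`, `rb` the BLOCK-COLUMN ∕ BLOCK-ROW |·|-MASSES of the two legs (all sums finite;
# ANY two legs `A B : MKer 4 Unit`, no decay, no symmetry used)

HONEST DEPENDENCY (cell records, verbatim): «continuum YM on T⁴ ⇐ BetaPertH ∧ nine spine estimates (0/9 proved); BetaPertH ⇐ (D1) ∧ (D4) ∧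
CAP+tail; G-an2-4 gates asym, D1 and NE2/3/4.»  HONEST FRAMING (cell contract, verbatim): «discharging `BetaPertH` makes Bałaban's UV stability
UNCONDITIONAL — a real constructive-QFT result; it is NOT the continuum limit and NOT the Clay problem.»  THIS MODULE DISCHARGES NOTHING of the wall:
it is [folklore] FINITE-SUM bookkeeping BY NAME — the rooted twins of leaf-04-g6's `CornerVBlockRank.qAnti_eq_rankTwo` ∕ `comp_qAnti_apply` for
`GhostStencilRooted.qAntiAt ρ n`, the dipole `CornerVBlockRank.comp_ghCur_apply`, two `tsum_eq_sum` collapses of `ExpKernelCalculus.tr`∕`comp`, and the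
sharp jet size `GhostNeedleRootedLetters.abs_qJetAt_le_inv_pow_four` (p256404).  No `def`, no `def … : Prop`, nothing cited, 0 sorry.  Asserts NO bound
on any leg: the legs enter the letter ONLY through their block-row ∕ block-column |·|-masses at the four sites `p, p + e_κ` — which is exactly the
currency of the located missing leg letter M10 (owner ruling ρ-g9-28 (f): displayed, not minted).  Root-level binders hW ∕ hR-sockets ∕ hSX-socket ∕
D1Tel ∕ D1Rep — 0 discharged; (K) NOT closed; NOT D1, NOT `BetaPertH`, NOT continuum, NOT Clay.

ABSOLUTE RULE (cell charter, verbatim): «No internally-minted statement may enter as a cited fact. Every hypothesis is either kernel-proved in this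
package or a verbatim quotation of a PUBLISHED theorem with page reference. The manuscript(s) under audit are NOT citable for their own disputed
steps — they are the thing under adjudication; programme-internal (2001/route/tribunal) claims are never citable.»

WHY (owner d1-p2-g9 «NEEDLE-GLUE» `NeedleRowGlue.abs_gN_row_le_of_tables` p255957 ✓ rows `h₄` (`T₄ = biBubbleTable (Ggh n a) (Ggh n a) ghCur
(qAntiAt (ctrHalf n) n) μ ν (b+w) b`) and `h₅` (`qA ⊗ ghCur`); ruling ρ-g9-28 (d) «T4∕T5 (`ghCur ⊗ qA` over `Ggh`, an3 §4's cleanest) … first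
refusal gan24-leaf-05 lineage», (b) «each `hᵢ` is composed from (S) sup + (M) ℓ¹ masses + (P) support∕count … NO `hᵢ` through
`exists_biLoc_SbRc`∕`biLoc_qAntiAt`-type sockets», (f) «M10 (near-field block-row |·|-mass of the scalar ghost leg, n-free) IS THE LOCATED MISSING
LETTER OF ROW (N) … enters EXACTLY like `h12`: a displayed statement»; an3-g56 (N-1) memo 7fa163ef7e91e99e §4 T4∕T5).  With `V := ghCur κ p` and
`W := qAntiAt ρ n λ u` every sum in `biBubble A V B W = tr ((A∘V)∘(B∘W))` is FINITE: `A∘V` has the two columns `z ∈ {p, p+e_κ}`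
(`comp_ghCur_apply`), `B∘W` is supported in the bond's block `B(blk u)` in its second slot and is the rank-two expression `R_B(z)·g(x) − ρ_B(z)` there
(`comp_qAntiAt_apply`, `g := qJetAt ρ n λ u (blk u)`, `R_B z := Σ_{t ∈ B(blk u)} B z t`, `ρ_B z := Σ_{t ∈ B(blk u)} B z t·g t`); hence the word is the
four-term closed form of §2 and its modulus is at most `n⁻⁴ × (block masses)` (§3) — the leg letter is consumed later, in FILE B, as a hypothesis.

CONTENT (all [folklore]; `B = B6QGQLower276.B (n − 1)`, `blk = blk (n − 1)`; every root `ρ`; fibre `Unit`).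
* §1 rooted rank two: `qJetAt_blk_eq`, **`qAntiAt_eq_rankTwo`**, `summand_qAntiAt_eq_zero`, **`comp_qAntiAt_apply`** (ANY left factor),
  `comp_qAntiAt_eq_zero_of_not_mem`.
* §2 closed forms: **`biBubble_ghCur_qAntiAt`** (`= R_B p·γ_A(p+e_κ) − ρ_B p·C_A(p+e_κ) − R_B(p+e_κ)·γ_A p + ρ_B(p+e_κ)·C_A p`, block COLUMN sums
  `C_A y := Σ_{x ∈ B} A x y`, `γ_A y := Σ_{x ∈ B} A x y·g x`) and the other order **`biBubble_qAntiAt_ghCur`** (needle on the first line, current on the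
  second: block ROW sums of `A`, block COLUMN sums of `B`); the table forms `biBubbleTable_ghCur_qAntiAt_eq` ∕ `biBubbleTable_qAntiAt_ghCur_eq`.
* §3 pointwise letters (`[NeZero n]`): **`abs_biBubbleTable_ghCur_qAntiAt_le`**
  (`|biBubbleTable A B ghCur (qAntiAt ρ n) κ λ p u| ≤ n⁻⁴·((Σ_{t∈B}|B p t|)·(Σ_{x∈B}|A x (p+e_κ)|) + (Σ_{t∈B}|B (p+e_κ) t|)·(Σ_{x∈B}|A x p|))`) and
  **`abs_biBubbleTable_qAntiAt_ghCur_le`** (`|biBubbleTable A B (qAntiAt ρ n) ghCur λ κ u p| ≤ n⁻⁴·((Σ_{t∈B}|A p t|… rows of A, columns of B)`).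
Unit `b2b-balaban-gan24-formalise-leaf-05` (gen 41), G-an2-4 swarm leaf prover on cross-lane kernel duty; `LEAVES-BFx.md` row (N) ∕ (N-2) «NT-4»∕«NT-5» FILE A.
-/

noncomputable section

namespace Summit.QuantumFields.BalabanUV.Beta.D1BFx.NeedleGhostBubblePointwise

open Finset
open scoped BigOperators
open Literature.MathematicalPhysics.QuantumFieldTheory.Balaban1983to89
open Literature.MathematicalPhysics.QuantumFieldTheory.Balaban1983to89.Beta
open B6QGQLower276 (blk B mem_B)
open ExpKernelCalculus (Site MKer comp tr)
open AffineAveraging (unitVec)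
open GhostStencil (ghCur ghCur_apply unitVec_ne_zero)
open Summit.QuantumFields.BalabanUV.Beta.D1BFx.PackedKernelSplit (biBubble)
open Summit.QuantumFields.BalabanUV.Beta.D1BFx.FineHessianSectors (biBubbleTable biBubbleTable_apply)
open Summit.QuantumFields.BalabanUV.Beta.D1BFx.GhostStencilRooted (qJetAt qAntiAt qAntiAt_apply qJetAt_eq_zero)
open Summit.QuantumFields.BalabanUV.Beta.D1BFx.GhostNeedleRootedLetters (abs_qJetAt_le_inv_pow_four)
open Summit.QuantumFields.BalabanUV.Beta.D1BFx.CornerVBlockRank (comp_ghCur_apply comp_ghCur_eq_zero_of_ne ghCur_eq_zero_of_ne)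

variable (ρ : Site 4) (n : ℕ) (lam : Fin 4) (u : Site 4)

/-! ## §1 The rooted needle is rank two on its bond's block; left composition with any kernel -/

/-- [folklore] Freezing the block label of the rooted jet: `qJetAt ρ n λ u (blk x) z = 1_B(x)·qJetAt ρ n λ u (blk u) z`. -/
theorem qJetAt_blk_eq (x z : Site 4) :
    qJetAt ρ n lam u (blk (n - 1) x) z = (if blk (n - 1) x = blk (n - 1) u then 1 else 0) * qJetAt ρ n lam u (blk (n - 1) u) z := by
  by_cases h : blk (n - 1) x = blk (n - 1) u
  · rw [h, if_pos rfl, one_mul]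
  · rw [if_neg h, zero_mul, qJetAt_eq_zero ρ n lam u (fun hh => h hh.2.symm)]

/-- [folklore] **`qAntiAt ρ n` IS RANK TWO**: `qAntiAt ρ n λ u x z = 1_B(x)·g(z) − 1_B(z)·g(x)`, `g = qJetAt ρ n λ u (blk u)` the rooted needle of
the bond, `1_B` the indicator of the bond's block (rooted twin of `CornerVBlockRank.qAnti_eq_rankTwo`). -/
theorem qAntiAt_eq_rankTwo (x z : Site 4) (v w : Unit) :
    qAntiAt ρ n lam u x z v w =
      (if blk (n - 1) x = blk (n - 1) u then 1 else 0) * qJetAt ρ n lam u (blk (n - 1) u) z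
        - (if blk (n - 1) z = blk (n - 1) u then 1 else 0) * qJetAt ρ n lam u (blk (n - 1) u) x := by
  rw [qAntiAt_apply, qJetAt_blk_eq ρ n lam u x z, qJetAt_blk_eq ρ n lam u z x]

/-- [folklore] Off the bond's block the needle vanishes: `g x = 0` for `x ∉ B(blk u)`. -/
theorem qJetAt_root_eq_zero_of_not_mem {x : Site 4} (hx : x ∉ B (n - 1) (blk (n - 1) u)) : qJetAt ρ n lam u (blk (n - 1) u) x = 0 :=
  qJetAt_eq_zero ρ n lam u (fun h => hx (mem_B.2 h.1))

/-- [folklore] Off the bond's block every summand of `B∘qAntiAt` vanishes. -/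
theorem summand_qAntiAt_eq_zero (K : MKer 4 Unit) (x z : Site 4) (v w : Unit) {y : Site 4} (hy : y ∉ B (n - 1) (blk (n - 1) u)) :
    K x y v () * qAntiAt ρ n lam u y z () w = 0 := by
  have hy' : ¬ blk (n - 1) y = blk (n - 1) u := fun h => hy (mem_B.2 h)
  rw [qAntiAt_eq_rankTwo, if_neg hy', zero_mul, qJetAt_root_eq_zero_of_not_mem ρ n lam u hy, mul_zero, sub_zero, mul_zero]

/-- [folklore] **LEFT COMPOSITION WITH THE ROOTED NEEDLE** (ANY left factor `K`; the `tsum` collapses to the bond's block):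
`(K∘qAntiAt ρ n λ u)(x,z) = (Σ_{y ∈ B} K x y)·g z − 1_B(z)·Σ_{y ∈ B} K x y·g y`. -/
theorem comp_qAntiAt_apply (K : MKer 4 Unit) (x z : Site 4) (v w : Unit) :
    comp K (qAntiAt ρ n lam u) x z v w =
      (∑ y ∈ B (n - 1) (blk (n - 1) u), K x y v ()) * qJetAt ρ n lam u (blk (n - 1) u) z
        - (if blk (n - 1) z = blk (n - 1) u then 1 else 0) *
            ∑ y ∈ B (n - 1) (blk (n - 1) u), K x y v () * qJetAt ρ n lam u (blk (n - 1) u) y := by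
  unfold comp
  simp only [Finset.univ_unique, PUnit.default_eq_unit, Finset.sum_singleton]
  rw [tsum_eq_sum (s := B (n - 1) (blk (n - 1) u)) (fun y hy => summand_qAntiAt_eq_zero ρ n lam u K x z v w hy)]
  have e : ∀ y ∈ B (n - 1) (blk (n - 1) u), K x y v () * qAntiAt ρ n lam u y z () w =
      K x y v () * qJetAt ρ n lam u (blk (n - 1) u) z
        - (if blk (n - 1) z = blk (n - 1) u then 1 else 0) * (K x y v () * qJetAt ρ n lam u (blk (n - 1) u) y) := by
    intro y hy
    rw [qAntiAt_eq_rankTwo, if_pos (mem_B.1 hy)]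
    ring
  rw [Finset.sum_congr rfl e, Finset.sum_sub_distrib, Finset.sum_mul, Finset.mul_sum]

/-- [folklore] `(K∘qAntiAt ρ n λ u)(x,z) = 0` unless `z` lies in the bond's block. -/
theorem comp_qAntiAt_eq_zero_of_not_mem (K : MKer 4 Unit) (x : Site 4) (v w : Unit) {z : Site 4} (hz : z ∉ B (n - 1) (blk (n - 1) u)) :
    comp K (qAntiAt ρ n lam u) x z v w = 0 := by
  have hz' : ¬ blk (n - 1) z = blk (n - 1) u := fun h => hz (mem_B.2 h)
  rw [comp_qAntiAt_apply, if_neg hz', zero_mul, sub_zero, qJetAt_root_eq_zero_of_not_mem ρ n lam u hz, mul_zero]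

/-! ## §2 The two ghost bubble words in closed form (finite sums; any two legs) -/

variable (A K : MKer 4 Unit) (κ : Fin 4) (p : Site 4)

/-- [folklore] The two sites of a bond are distinct. -/
theorem bond_ne : (p + unitVec κ : Site 4) ≠ p := fun h =>
  unitVec_ne_zero κ (add_left_cancel (show p + unitVec κ = p + 0 by rw [add_zero]; exact h))

/-- [folklore] **CLOSED FORM OF `ghCur ⊗ qA`** — current on the first line (a dipole at `p`), rooted needle on the second (block row sums of the second
leg `K` and block column sums of the first leg `A` at the needle's block `B = B(blk u)`, weighted by `g = qJetAt ρ n λ u (blk u)`):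
`biBubble A (ghCur κ p) K (qAntiAt ρ n λ u) = R_K p·γ_A(p+e_κ) − ρ_K p·C_A(p+e_κ) − R_K(p+e_κ)·γ_A p + ρ_K(p+e_κ)·C_A p`. -/
theorem biBubble_ghCur_qAntiAt :
    biBubble A (ghCur κ p) K (qAntiAt ρ n lam u) =
      (∑ t ∈ B (n - 1) (blk (n - 1) u), K p t () ()) *
          (∑ x ∈ B (n - 1) (blk (n - 1) u), A x (p + unitVec κ) () () * qJetAt ρ n lam u (blk (n - 1) u) x)
        - (∑ t ∈ B (n - 1) (blk (n - 1) u), K p t () () * qJetAt ρ n lam u (blk (n - 1) u) t) *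
          (∑ x ∈ B (n - 1) (blk (n - 1) u), A x (p + unitVec κ) () ())
        - (∑ t ∈ B (n - 1) (blk (n - 1) u), K (p + unitVec κ) t () ()) *
          (∑ x ∈ B (n - 1) (blk (n - 1) u), A x p () () * qJetAt ρ n lam u (blk (n - 1) u) x)
        + (∑ t ∈ B (n - 1) (blk (n - 1) u), K (p + unitVec κ) t () () * qJetAt ρ n lam u (blk (n - 1) u) t) *
          (∑ x ∈ B (n - 1) (blk (n - 1) u), A x p () ()) := by
  classical
  unfold biBubble tr
  simp only [Finset.univ_unique, PUnit.default_eq_unit, Finset.sum_singleton]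
  -- the diagonal of `(A∘V)∘(K∘W)` at `x`: the `z`-sum has the two terms `z = p`, `z = p + e_κ`
  have hdiag : ∀ x : Site 4, comp (comp A (ghCur κ p)) (comp K (qAntiAt ρ n lam u)) x x () () =
      A x (p + unitVec κ) () () * comp K (qAntiAt ρ n lam u) p x () ()
        - A x p () () * comp K (qAntiAt ρ n lam u) (p + unitVec κ) x () () := by
    intro x
    rw [show comp (comp A (ghCur κ p)) (comp K (qAntiAt ρ n lam u)) x x () () =
      ∑' z, ∑ f : Unit, comp A (ghCur κ p) x z () f * comp K (qAntiAt ρ n lam u) z x f () from rfl]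
    simp only [Finset.univ_unique, PUnit.default_eq_unit, Finset.sum_singleton]
    rw [tsum_eq_sum (s := ({p + unitVec κ, p} : Finset (Site 4)))
      (fun z hz => by
        rw [Finset.mem_insert, Finset.mem_singleton, not_or] at hz
        rw [comp_ghCur_eq_zero_of_ne κ p A x () () hz.1 hz.2, zero_mul]),
      Finset.sum_pair (bond_ne κ p), comp_ghCur_apply, comp_ghCur_apply]
    simp only [bond_ne κ p, (bond_ne κ p).symm, if_true, if_false, mul_one, mul_zero, sub_zero, zero_sub]
    ring
  simp only [hdiag]
  -- off the needle's block the diagonal vanishes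
  rw [tsum_eq_sum (s := B (n - 1) (blk (n - 1) u))
    (fun x hx => by
      rw [comp_qAntiAt_eq_zero_of_not_mem ρ n lam u K p () () hx,
        comp_qAntiAt_eq_zero_of_not_mem ρ n lam u K (p + unitVec κ) () () hx, mul_zero, mul_zero, sub_zero])]
  have e : ∀ x ∈ B (n - 1) (blk (n - 1) u),
      A x (p + unitVec κ) () () * comp K (qAntiAt ρ n lam u) p x () () - A x p () () * comp K (qAntiAt ρ n lam u) (p + unitVec κ) x () () =
        (∑ t ∈ B (n - 1) (blk (n - 1) u), K p t () ()) * (A x (p + unitVec κ) () () * qJetAt ρ n lam u (blk (n - 1) u) x)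
          - (∑ t ∈ B (n - 1) (blk (n - 1) u), K p t () () * qJetAt ρ n lam u (blk (n - 1) u) t) * A x (p + unitVec κ) () ()
          - (∑ t ∈ B (n - 1) (blk (n - 1) u), K (p + unitVec κ) t () ()) * (A x p () () * qJetAt ρ n lam u (blk (n - 1) u) x)
          + (∑ t ∈ B (n - 1) (blk (n - 1) u), K (p + unitVec κ) t () () * qJetAt ρ n lam u (blk (n - 1) u) t) * A x p () () := by
    intro x hx
    rw [comp_qAntiAt_apply, comp_qAntiAt_apply, if_pos (mem_B.1 hx)]
    ring
  rw [Finset.sum_congr rfl e, Finset.sum_add_distrib, Finset.sum_sub_distrib, Finset.sum_sub_distrib, ← Finset.mul_sum, ← Finset.mul_sum,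
    ← Finset.mul_sum, ← Finset.mul_sum]

/-- [folklore] **CLOSED FORM OF `qA ⊗ ghCur`** — rooted needle on the first line (block ROW sums of the first leg `A`), current on the second (block
COLUMN sums of the second leg `K`): `biBubble A (qAntiAt ρ n λ u) K (ghCur κ p) = R_A p·γ′_K(p+e_κ) − ρ_A p·C_K(p+e_κ) − R_A(p+e_κ)·γ′_K p + ρ_A(p+e_κ)·C_K p`,
`R_A y := Σ_{t∈B} A y t`, `ρ_A y := Σ_{t∈B} A y t·g t`, `C_K y := Σ_{z∈B} K z y`, `γ′_K y := Σ_{z∈B} g z·K z y`. -/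
theorem biBubble_qAntiAt_ghCur :
    biBubble A (qAntiAt ρ n lam u) K (ghCur κ p) =
      (∑ t ∈ B (n - 1) (blk (n - 1) u), A p t () ()) *
          (∑ z ∈ B (n - 1) (blk (n - 1) u), qJetAt ρ n lam u (blk (n - 1) u) z * K z (p + unitVec κ) () ())
        - (∑ t ∈ B (n - 1) (blk (n - 1) u), A p t () () * qJetAt ρ n lam u (blk (n - 1) u) t) *
          (∑ z ∈ B (n - 1) (blk (n - 1) u), K z (p + unitVec κ) () ())
        - (∑ t ∈ B (n - 1) (blk (n - 1) u), A (p + unitVec κ) t () ()) *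
          (∑ z ∈ B (n - 1) (blk (n - 1) u), qJetAt ρ n lam u (blk (n - 1) u) z * K z p () ())
        + (∑ t ∈ B (n - 1) (blk (n - 1) u), A (p + unitVec κ) t () () * qJetAt ρ n lam u (blk (n - 1) u) t) *
          (∑ z ∈ B (n - 1) (blk (n - 1) u), K z p () ()) := by
  classical
  unfold biBubble tr
  simp only [Finset.univ_unique, PUnit.default_eq_unit, Finset.sum_singleton]
  -- the diagonal of `(A∘W)∘(K∘V)` at `x`: the `z`-sum collapses to the needle's block
  have hdiag : ∀ x : Site 4, comp (comp A (qAntiAt ρ n lam u)) (comp K (ghCur κ p)) x x () () =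
      ∑ z ∈ B (n - 1) (blk (n - 1) u), comp A (qAntiAt ρ n lam u) x z () () * comp K (ghCur κ p) z x () () := by
    intro x
    rw [show comp (comp A (qAntiAt ρ n lam u)) (comp K (ghCur κ p)) x x () () =
      ∑' z, ∑ f : Unit, comp A (qAntiAt ρ n lam u) x z () f * comp K (ghCur κ p) z x f () from rfl]
    simp only [Finset.univ_unique, PUnit.default_eq_unit, Finset.sum_singleton]
    exact tsum_eq_sum (s := B (n - 1) (blk (n - 1) u))
      (fun z hz => by rw [comp_qAntiAt_eq_zero_of_not_mem ρ n lam u A x () () hz, zero_mul])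
  simp only [hdiag]
  -- off the two sites of the current's bond the diagonal vanishes
  rw [tsum_eq_sum (s := ({p + unitVec κ, p} : Finset (Site 4)))
    (fun x hx => by
      rw [Finset.mem_insert, Finset.mem_singleton, not_or] at hx
      exact Finset.sum_eq_zero fun z _ => by rw [comp_ghCur_eq_zero_of_ne κ p K z () () hx.1 hx.2, mul_zero]),
    Finset.sum_pair (bond_ne κ p)]
  have e1 : ∀ z ∈ B (n - 1) (blk (n - 1) u),
      comp A (qAntiAt ρ n lam u) (p + unitVec κ) z () () * comp K (ghCur κ p) z (p + unitVec κ) () () =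
        -((∑ t ∈ B (n - 1) (blk (n - 1) u), A (p + unitVec κ) t () ()) * (qJetAt ρ n lam u (blk (n - 1) u) z * K z p () ())
          - (∑ t ∈ B (n - 1) (blk (n - 1) u), A (p + unitVec κ) t () () * qJetAt ρ n lam u (blk (n - 1) u) t) * K z p () ()) := by
    intro z hz
    rw [comp_qAntiAt_apply, if_pos (mem_B.1 hz), comp_ghCur_apply]
    simp only [bond_ne κ p, if_true, if_false, mul_one, mul_zero, zero_sub]
    ring
  have e2 : ∀ z ∈ B (n - 1) (blk (n - 1) u),
      comp A (qAntiAt ρ n lam u) p z () () * comp K (ghCur κ p) z p () () =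
        (∑ t ∈ B (n - 1) (blk (n - 1) u), A p t () ()) * (qJetAt ρ n lam u (blk (n - 1) u) z * K z (p + unitVec κ) () ())
          - (∑ t ∈ B (n - 1) (blk (n - 1) u), A p t () () * qJetAt ρ n lam u (blk (n - 1) u) t) * K z (p + unitVec κ) () () := by
    intro z hz
    rw [comp_qAntiAt_apply, if_pos (mem_B.1 hz), comp_ghCur_apply]
    simp only [(bond_ne κ p).symm, if_true, if_false, mul_one, mul_zero, sub_zero]
    ring
  rw [Finset.sum_congr rfl e1, Finset.sum_congr rfl e2, Finset.sum_neg_distrib, Finset.sum_sub_distrib, Finset.sum_sub_distrib,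
    ← Finset.mul_sum, ← Finset.mul_sum, ← Finset.mul_sum, ← Finset.mul_sum]
  ring

/-- [folklore] The table form of §2 (`FineHessianSectors.biBubbleTable_apply`): `ghCur ⊗ qA` at the bonds `(κ, p)`, `(λ, u)`. -/
theorem biBubbleTable_ghCur_qAntiAt_eq :
    biBubbleTable A K ghCur (qAntiAt ρ n) κ lam p u =
      -(1 / 2 : ℝ) * ((∑ t ∈ B (n - 1) (blk (n - 1) u), K p t () ()) *
          (∑ x ∈ B (n - 1) (blk (n - 1) u), A x (p + unitVec κ) () () * qJetAt ρ n lam u (blk (n - 1) u) x)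
        - (∑ t ∈ B (n - 1) (blk (n - 1) u), K p t () () * qJetAt ρ n lam u (blk (n - 1) u) t) *
          (∑ x ∈ B (n - 1) (blk (n - 1) u), A x (p + unitVec κ) () ())
        - (∑ t ∈ B (n - 1) (blk (n - 1) u), K (p + unitVec κ) t () ()) *
          (∑ x ∈ B (n - 1) (blk (n - 1) u), A x p () () * qJetAt ρ n lam u (blk (n - 1) u) x)
        + (∑ t ∈ B (n - 1) (blk (n - 1) u), K (p + unitVec κ) t () () * qJetAt ρ n lam u (blk (n - 1) u) t) *
          (∑ x ∈ B (n - 1) (blk (n - 1) u), A x p () ())) := by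
  rw [biBubbleTable_apply, biBubble_ghCur_qAntiAt]

/-- [folklore] The table form of §2: `qA ⊗ ghCur` at the bonds `(λ, u)`, `(κ, p)`. -/
theorem biBubbleTable_qAntiAt_ghCur_eq :
    biBubbleTable A K (qAntiAt ρ n) ghCur lam κ u p =
      -(1 / 2 : ℝ) * ((∑ t ∈ B (n - 1) (blk (n - 1) u), A p t () ()) *
          (∑ z ∈ B (n - 1) (blk (n - 1) u), qJetAt ρ n lam u (blk (n - 1) u) z * K z (p + unitVec κ) () ())
        - (∑ t ∈ B (n - 1) (blk (n - 1) u), A p t () () * qJetAt ρ n lam u (blk (n - 1) u) t) *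
          (∑ z ∈ B (n - 1) (blk (n - 1) u), K z (p + unitVec κ) () ())
        - (∑ t ∈ B (n - 1) (blk (n - 1) u), A (p + unitVec κ) t () ()) *
          (∑ z ∈ B (n - 1) (blk (n - 1) u), qJetAt ρ n lam u (blk (n - 1) u) z * K z p () ())
        + (∑ t ∈ B (n - 1) (blk (n - 1) u), A (p + unitVec κ) t () () * qJetAt ρ n lam u (blk (n - 1) u) t) *
          (∑ z ∈ B (n - 1) (blk (n - 1) u), K z p () ())) := by
  rw [biBubbleTable_apply, biBubble_qAntiAt_ghCur]

/-! ## §3 The pointwise letters: `n⁻⁴ ×` block-row ∕ block-column masses of the legs -/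

variable [NeZero n]

/-- [folklore] A needle-weighted block sum is at most `n⁻⁴` times the block |·|-mass (`|qJetAt| ≤ n⁻⁴`, `GhostNeedleRootedLetters.abs_qJetAt_le_inv_pow_four`). -/
theorem abs_sum_mul_qJetAt_le (f : Site 4 → ℝ) :
    |∑ x ∈ B (n - 1) (blk (n - 1) u), f x * qJetAt ρ n lam u (blk (n - 1) u) x|
      ≤ ((n : ℝ) ^ 4)⁻¹ * ∑ x ∈ B (n - 1) (blk (n - 1) u), |f x| := by
  calc |∑ x ∈ B (n - 1) (blk (n - 1) u), f x * qJetAt ρ n lam u (blk (n - 1) u) x|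
      ≤ ∑ x ∈ B (n - 1) (blk (n - 1) u), |f x * qJetAt ρ n lam u (blk (n - 1) u) x| := Finset.abs_sum_le_sum_abs _ _
    _ ≤ ∑ x ∈ B (n - 1) (blk (n - 1) u), |f x| * ((n : ℝ) ^ 4)⁻¹ := Finset.sum_le_sum fun x _ => by
        rw [abs_mul]; exact mul_le_mul_of_nonneg_left (abs_qJetAt_le_inv_pow_four ρ n lam u _ x) (abs_nonneg _)
    _ = ((n : ℝ) ^ 4)⁻¹ * ∑ x ∈ B (n - 1) (blk (n - 1) u), |f x| := by rw [← Finset.sum_mul, mul_comm]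

/-- [folklore] The same with the jet on the left of the product. -/
theorem abs_sum_qJetAt_mul_le (f : Site 4 → ℝ) :
    |∑ x ∈ B (n - 1) (blk (n - 1) u), qJetAt ρ n lam u (blk (n - 1) u) x * f x|
      ≤ ((n : ℝ) ^ 4)⁻¹ * ∑ x ∈ B (n - 1) (blk (n - 1) u), |f x| := by
  have h := abs_sum_mul_qJetAt_le ρ n lam u f
  rwa [show (∑ x ∈ B (n - 1) (blk (n - 1) u), qJetAt ρ n lam u (blk (n - 1) u) x * f x)
      = ∑ x ∈ B (n - 1) (blk (n - 1) u), f x * qJetAt ρ n lam u (blk (n - 1) u) x from Finset.sum_congr rfl fun x _ => mul_comm _ _]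

/-- [folklore] **THE POINTWISE LETTER OF `ghCur ⊗ qA`**: for ANY two legs,
`|biBubbleTable A K ghCur (qAntiAt ρ n) κ λ p u| ≤ n⁻⁴·((Σ_{t∈B}|K p t|)·(Σ_{x∈B}|A x (p+e_κ)|) + (Σ_{t∈B}|K (p+e_κ) t|)·(Σ_{x∈B}|A x p|))`, `B = B(blk u)` —
the legs enter only through their block-row (`K`) and block-column (`A`) |·|-masses at the two sites of the current's bond. -/
theorem abs_biBubbleTable_ghCur_qAntiAt_le :
    |biBubbleTable A K ghCur (qAntiAt ρ n) κ lam p u| ≤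
      ((n : ℝ) ^ 4)⁻¹ * ((∑ t ∈ B (n - 1) (blk (n - 1) u), |K p t () ()|) * (∑ x ∈ B (n - 1) (blk (n - 1) u), |A x (p + unitVec κ) () ()|)
        + (∑ t ∈ B (n - 1) (blk (n - 1) u), |K (p + unitVec κ) t () ()|) * (∑ x ∈ B (n - 1) (blk (n - 1) u), |A x p () ()|)) := by
  have hn : (0 : ℝ) < n := Nat.cast_pos.mpr (Nat.pos_of_ne_zero (NeZero.ne n))
  have hw : (0 : ℝ) ≤ ((n : ℝ) ^ 4)⁻¹ := inv_nonneg.mpr (pow_pos hn 4).le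
  set RB0 := ∑ t ∈ B (n - 1) (blk (n - 1) u), K p t () () with hRB0
  set RB1 := ∑ t ∈ B (n - 1) (blk (n - 1) u), K (p + unitVec κ) t () () with hRB1
  set rB0 := ∑ t ∈ B (n - 1) (blk (n - 1) u), K p t () () * qJetAt ρ n lam u (blk (n - 1) u) t with hrB0
  set rB1 := ∑ t ∈ B (n - 1) (blk (n - 1) u), K (p + unitVec κ) t () () * qJetAt ρ n lam u (blk (n - 1) u) t with hrB1
  set CA0 := ∑ x ∈ B (n - 1) (blk (n - 1) u), A x p () () with hCA0
  set CA1 := ∑ x ∈ B (n - 1) (blk (n - 1) u), A x (p + unitVec κ) () () with hCA1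
  set gA0 := ∑ x ∈ B (n - 1) (blk (n - 1) u), A x p () () * qJetAt ρ n lam u (blk (n - 1) u) x with hgA0
  set gA1 := ∑ x ∈ B (n - 1) (blk (n - 1) u), A x (p + unitVec κ) () () * qJetAt ρ n lam u (blk (n - 1) u) x with hgA1
  set mB0 := ∑ t ∈ B (n - 1) (blk (n - 1) u), |K p t () ()| with hmB0
  set mB1 := ∑ t ∈ B (n - 1) (blk (n - 1) u), |K (p + unitVec κ) t () ()| with hmB1
  set mA0 := ∑ x ∈ B (n - 1) (blk (n - 1) u), |A x p () ()| with hmA0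
  set mA1 := ∑ x ∈ B (n - 1) (blk (n - 1) u), |A x (p + unitVec κ) () ()| with hmA1
  have h1 : |RB0| ≤ mB0 := Finset.abs_sum_le_sum_abs _ _
  have h2 : |RB1| ≤ mB1 := Finset.abs_sum_le_sum_abs _ _
  have h3 : |CA0| ≤ mA0 := Finset.abs_sum_le_sum_abs _ _
  have h4 : |CA1| ≤ mA1 := Finset.abs_sum_le_sum_abs _ _
  have h5 : |rB0| ≤ ((n : ℝ) ^ 4)⁻¹ * mB0 := abs_sum_mul_qJetAt_le ρ n lam u _
  have h6 : |rB1| ≤ ((n : ℝ) ^ 4)⁻¹ * mB1 := abs_sum_mul_qJetAt_le ρ n lam u _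
  have h7 : |gA0| ≤ ((n : ℝ) ^ 4)⁻¹ * mA0 := abs_sum_mul_qJetAt_le ρ n lam u _
  have h8 : |gA1| ≤ ((n : ℝ) ^ 4)⁻¹ * mA1 := abs_sum_mul_qJetAt_le ρ n lam u _
  have hm1 : 0 ≤ mB0 := Finset.sum_nonneg fun _ _ => abs_nonneg _
  have hm2 : 0 ≤ mB1 := Finset.sum_nonneg fun _ _ => abs_nonneg _
  have hm3 : 0 ≤ mA0 := Finset.sum_nonneg fun _ _ => abs_nonneg _
  have hm4 : 0 ≤ mA1 := Finset.sum_nonneg fun _ _ => abs_nonneg _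
  rw [biBubbleTable_ghCur_qAntiAt_eq, abs_mul, show |(-(1 / 2 : ℝ))| = 1 / 2 by norm_num]
  have hT1 : |RB0 * gA1| ≤ mB0 * (((n : ℝ) ^ 4)⁻¹ * mA1) := by
    rw [abs_mul]; exact mul_le_mul h1 h8 (abs_nonneg _) hm1
  have hT2 : |rB0 * CA1| ≤ ((n : ℝ) ^ 4)⁻¹ * mB0 * mA1 := by
    rw [abs_mul]; exact mul_le_mul h5 h4 (abs_nonneg _) (mul_nonneg hw hm1)
  have hT3 : |RB1 * gA0| ≤ mB1 * (((n : ℝ) ^ 4)⁻¹ * mA0) := by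
    rw [abs_mul]; exact mul_le_mul h2 h7 (abs_nonneg _) hm2
  have hT4 : |rB1 * CA0| ≤ ((n : ℝ) ^ 4)⁻¹ * mB1 * mA0 := by
    rw [abs_mul]; exact mul_le_mul h6 h3 (abs_nonneg _) (mul_nonneg hw hm2)
  have hsum : |RB0 * gA1 - rB0 * CA1 - RB1 * gA0 + rB1 * CA0| ≤
      mB0 * (((n : ℝ) ^ 4)⁻¹ * mA1) + ((n : ℝ) ^ 4)⁻¹ * mB0 * mA1 + mB1 * (((n : ℝ) ^ 4)⁻¹ * mA0) + ((n : ℝ) ^ 4)⁻¹ * mB1 * mA0 := by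
    calc |RB0 * gA1 - rB0 * CA1 - RB1 * gA0 + rB1 * CA0|
        ≤ |RB0 * gA1 - rB0 * CA1 - RB1 * gA0| + |rB1 * CA0| := abs_add_le _ _
      _ ≤ |RB0 * gA1 - rB0 * CA1| + |RB1 * gA0| + |rB1 * CA0| := by linarith [abs_sub (RB0 * gA1 - rB0 * CA1) (RB1 * gA0)]
      _ ≤ |RB0 * gA1| + |rB0 * CA1| + |RB1 * gA0| + |rB1 * CA0| := by linarith [abs_sub (RB0 * gA1) (rB0 * CA1)]
      _ ≤ _ := by linarith
  calc 1 / 2 * |RB0 * gA1 - rB0 * CA1 - RB1 * gA0 + rB1 * CA0|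
      ≤ 1 / 2 * (mB0 * (((n : ℝ) ^ 4)⁻¹ * mA1) + ((n : ℝ) ^ 4)⁻¹ * mB0 * mA1 + mB1 * (((n : ℝ) ^ 4)⁻¹ * mA0)
          + ((n : ℝ) ^ 4)⁻¹ * mB1 * mA0) := mul_le_mul_of_nonneg_left hsum (by norm_num)
    _ = ((n : ℝ) ^ 4)⁻¹ * (mB0 * mA1 + mB1 * mA0) := by ring

/-- [folklore] **THE POINTWISE LETTER OF `qA ⊗ ghCur`**: for ANY two legs,
`|biBubbleTable A K (qAntiAt ρ n) ghCur λ κ u p| ≤ n⁻⁴·((Σ_{t∈B}|A p t|)·(Σ_{z∈B}|K z (p+e_κ)|) + (Σ_{t∈B}|A (p+e_κ) t|)·(Σ_{z∈B}|K z p|))` — block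
rows of the first leg, block columns of the second. -/
theorem abs_biBubbleTable_qAntiAt_ghCur_le :
    |biBubbleTable A K (qAntiAt ρ n) ghCur lam κ u p| ≤
      ((n : ℝ) ^ 4)⁻¹ * ((∑ t ∈ B (n - 1) (blk (n - 1) u), |A p t () ()|) * (∑ z ∈ B (n - 1) (blk (n - 1) u), |K z (p + unitVec κ) () ()|)
        + (∑ t ∈ B (n - 1) (blk (n - 1) u), |A (p + unitVec κ) t () ()|) * (∑ z ∈ B (n - 1) (blk (n - 1) u), |K z p () ()|)) := by
  have hn : (0 : ℝ) < n := Nat.cast_pos.mpr (Nat.pos_of_ne_zero (NeZero.ne n))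
  have hw : (0 : ℝ) ≤ ((n : ℝ) ^ 4)⁻¹ := inv_nonneg.mpr (pow_pos hn 4).le
  set RA0 := ∑ t ∈ B (n - 1) (blk (n - 1) u), A p t () () with hRA0
  set RA1 := ∑ t ∈ B (n - 1) (blk (n - 1) u), A (p + unitVec κ) t () () with hRA1
  set rA0 := ∑ t ∈ B (n - 1) (blk (n - 1) u), A p t () () * qJetAt ρ n lam u (blk (n - 1) u) t with hrA0
  set rA1 := ∑ t ∈ B (n - 1) (blk (n - 1) u), A (p + unitVec κ) t () () * qJetAt ρ n lam u (blk (n - 1) u) t with hrA1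
  set CK0 := ∑ z ∈ B (n - 1) (blk (n - 1) u), K z p () () with hCK0
  set CK1 := ∑ z ∈ B (n - 1) (blk (n - 1) u), K z (p + unitVec κ) () () with hCK1
  set gK0 := ∑ z ∈ B (n - 1) (blk (n - 1) u), qJetAt ρ n lam u (blk (n - 1) u) z * K z p () () with hgK0
  set gK1 := ∑ z ∈ B (n - 1) (blk (n - 1) u), qJetAt ρ n lam u (blk (n - 1) u) z * K z (p + unitVec κ) () () with hgK1
  set mA0 := ∑ t ∈ B (n - 1) (blk (n - 1) u), |A p t () ()| with hmA0
  set mA1 := ∑ t ∈ B (n - 1) (blk (n - 1) u), |A (p + unitVec κ) t () ()| with hmA1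
  set mK0 := ∑ z ∈ B (n - 1) (blk (n - 1) u), |K z p () ()| with hmK0
  set mK1 := ∑ z ∈ B (n - 1) (blk (n - 1) u), |K z (p + unitVec κ) () ()| with hmK1
  have h1 : |RA0| ≤ mA0 := Finset.abs_sum_le_sum_abs _ _
  have h2 : |RA1| ≤ mA1 := Finset.abs_sum_le_sum_abs _ _
  have h3 : |CK0| ≤ mK0 := Finset.abs_sum_le_sum_abs _ _
  have h4 : |CK1| ≤ mK1 := Finset.abs_sum_le_sum_abs _ _
  have h5 : |rA0| ≤ ((n : ℝ) ^ 4)⁻¹ * mA0 := abs_sum_mul_qJetAt_le ρ n lam u _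
  have h6 : |rA1| ≤ ((n : ℝ) ^ 4)⁻¹ * mA1 := abs_sum_mul_qJetAt_le ρ n lam u _
  have h7 : |gK0| ≤ ((n : ℝ) ^ 4)⁻¹ * mK0 := abs_sum_qJetAt_mul_le ρ n lam u _
  have h8 : |gK1| ≤ ((n : ℝ) ^ 4)⁻¹ * mK1 := abs_sum_qJetAt_mul_le ρ n lam u _
  have hm1 : 0 ≤ mA0 := Finset.sum_nonneg fun _ _ => abs_nonneg _
  have hm2 : 0 ≤ mA1 := Finset.sum_nonneg fun _ _ => abs_nonneg _
  have hm3 : 0 ≤ mK0 := Finset.sum_nonneg fun _ _ => abs_nonneg _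
  have hm4 : 0 ≤ mK1 := Finset.sum_nonneg fun _ _ => abs_nonneg _
  rw [biBubbleTable_qAntiAt_ghCur_eq, abs_mul, show |(-(1 / 2 : ℝ))| = 1 / 2 by norm_num]
  have hT1 : |RA0 * gK1| ≤ mA0 * (((n : ℝ) ^ 4)⁻¹ * mK1) := by
    rw [abs_mul]; exact mul_le_mul h1 h8 (abs_nonneg _) hm1
  have hT2 : |rA0 * CK1| ≤ ((n : ℝ) ^ 4)⁻¹ * mA0 * mK1 := by
    rw [abs_mul]; exact mul_le_mul h5 h4 (abs_nonneg _) (mul_nonneg hw hm1)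
  have hT3 : |RA1 * gK0| ≤ mA1 * (((n : ℝ) ^ 4)⁻¹ * mK0) := by
    rw [abs_mul]; exact mul_le_mul h2 h7 (abs_nonneg _) hm2
  have hT4 : |rA1 * CK0| ≤ ((n : ℝ) ^ 4)⁻¹ * mA1 * mK0 := by
    rw [abs_mul]; exact mul_le_mul h6 h3 (abs_nonneg _) (mul_nonneg hw hm2)
  have hsum : |RA0 * gK1 - rA0 * CK1 - RA1 * gK0 + rA1 * CK0| ≤
      mA0 * (((n : ℝ) ^ 4)⁻¹ * mK1) + ((n : ℝ) ^ 4)⁻¹ * mA0 * mK1 + mA1 * (((n : ℝ) ^ 4)⁻¹ * mK0) + ((n : ℝ) ^ 4)⁻¹ * mA1 * mK0 := by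
    calc |RA0 * gK1 - rA0 * CK1 - RA1 * gK0 + rA1 * CK0|
        ≤ |RA0 * gK1 - rA0 * CK1 - RA1 * gK0| + |rA1 * CK0| := abs_add_le _ _
      _ ≤ |RA0 * gK1 - rA0 * CK1| + |RA1 * gK0| + |rA1 * CK0| := by linarith [abs_sub (RA0 * gK1 - rA0 * CK1) (RA1 * gK0)]
      _ ≤ |RA0 * gK1| + |rA0 * CK1| + |RA1 * gK0| + |rA1 * CK0| := by linarith [abs_sub (RA0 * gK1) (rA0 * CK1)]
      _ ≤ _ := by linarith
  calc 1 / 2 * |RA0 * gK1 - rA0 * CK1 - RA1 * gK0 + rA1 * CK0|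
      ≤ 1 / 2 * (mA0 * (((n : ℝ) ^ 4)⁻¹ * mK1) + ((n : ℝ) ^ 4)⁻¹ * mA0 * mK1 + mA1 * (((n : ℝ) ^ 4)⁻¹ * mK0)
          + ((n : ℝ) ^ 4)⁻¹ * mA1 * mK0) := mul_le_mul_of_nonneg_left hsum (by norm_num)
    _ = ((n : ℝ) ^ 4)⁻¹ * (mA0 * mK1 + mA1 * mK0) := by ring

end Summit.QuantumFields.BalabanUV.Beta.D1BFx.NeedleGhostBubblePointwise

end
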